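import Mathlib.MeasureTheory.Integral.Bochner.Basic
import Mathlib.MeasureTheory.Function.LpSeminorm.CompareExp
import Mathlib.Analysis.SpecialFunctions.Pow.Real
import HarnessLib

/-!
# Two Hölder bounds for the window quantities of the local energy flux

Analysis/FluidPDE proof file (theorems only; no definitions, no named facts) on the discharge
path of the named fact `Literature.Analysis.FluidPDE.seregin_sverak_2002`
(`SereginSverakPressure.lean`; G. Seregin, V. Šverák, Arch. Ration. Mech. Anal. **163** (2002)
65–86). The window bound of `ClassicalLocalEnergyWindow.lean` /
`SereginSverakProbeEnergyNoJump.lean` is stated in terms of `m₃ = ∬_W |u|³` and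
`m_{pu} = ∬_W |q| |u|` on a space–time window `W`; the scale-invariant (Type I) information
available at a singular point concerns `∬ |u|^{10/3}` (the local Lebesgue interpolation,
`CKNTenThirdsInterpolation.lean`) and `∬ |q|^{3/2}` (the quantity `D`). The two are linked by
Hölder's inequality on the finite measure space `W`, which is all this file records, for an
arbitrary finite measure `μ`:

* `integral_norm_pow_three_le_rpow` —
  `∫ |u|³ dμ ≤ μ(univ)^{1/10} (∫ |u|^{10/3} dμ)^{9/10}` for bounded measurable `u`
  (exponents `10/9` and `10`); the first factor is the smallness `θ^{1/5}` of a parabolic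
  window of length `θ² r²` in a ball of radius `∼ r`;
* `integral_abs_mul_norm_le_rpow` —
  `∫ |q| |u| dμ ≤ (∫ |q|^{3/2} dμ)^{2/3} (∫ |u|³ dμ)^{1/3}` (exponents `3/2` and `3`).

## References

* G. Seregin, V. Šverák, Arch. Ration. Mech. Anal. 163 (2002), 65–86 (the result served).
  [SereginSverak2002]
* P. G. Lemarié-Rieusset, *The Navier–Stokes Problem in the 21st Century* (2016), §13.9
  p. 468 (the `L^{10/3}`–Hölder step (13.27)). [LemarieRieusset2016]
-/

noncomputable section

open MeasureTheory Set Function Filter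
open scoped ENNReal NNReal

namespace Literature.Analysis.FluidPDE

namespace SereginSverak2002

variable {X : Type*} [MeasurableSpace X] {μ : Measure X}
variable {F : Type*} [NormedAddCommGroup F]

/-- **Hölder with exponents `10/9`, `10`**: for a finite measure `μ` and a bounded
a.e.-strongly measurable `u`, `∫ |u|³ dμ ≤ μ(univ)^{1/10} (∫ |u|^{10/3} dμ)^{9/10}`. [folklore] -/
theorem integral_norm_pow_three_le_rpow [IsFiniteMeasure μ] {u : X → F}
    (hu : AEStronglyMeasurable u μ) {B : ℝ} (hB : ∀ᵐ x ∂μ, ‖u x‖ ≤ B) :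
    ∫ x, ‖u x‖ ^ 3 ∂μ ≤
      μ.real univ ^ (1 / 10 : ℝ) * (∫ x, ‖u x‖ ^ (10 / 3 : ℝ) ∂μ) ^ (9 / 10 : ℝ) := by
  have hpq : (10 / 9 : ℝ).HolderConjugate 10 := Real.holderConjugate_iff.2 ⟨by norm_num, by norm_num⟩
  -- `f = |u|³` is bounded by `|B|³`, `g = 1`
  have hf_meas : AEStronglyMeasurable (fun x => ‖u x‖ ^ 3) μ := (hu.norm.pow 3)
  have hf_bd : ∀ᵐ x ∂μ, ‖‖u x‖ ^ 3‖ ≤ |B| ^ 3 := by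
    filter_upwards [hB] with x hx
    rw [Real.norm_eq_abs, abs_pow, abs_norm]
    exact pow_le_pow_left₀ (norm_nonneg _) (hx.trans (le_abs_self B)) 3
  have hf : MemLp (fun x => ‖u x‖ ^ 3) (ENNReal.ofReal (10 / 9)) μ := MemLp.of_bound hf_meas _ hf_bd
  have hg : MemLp (fun _ : X => (1 : ℝ)) (ENNReal.ofReal 10) μ := memLp_const 1
  have key := integral_mul_le_Lp_mul_Lq_of_nonneg hpq
    (Eventually.of_forall fun x => by positivity) (Eventually.of_forall fun x => zero_le_one) hf hg
  -- rewrite the three integrals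
  have e1 : ∫ x, ‖u x‖ ^ 3 * (1 : ℝ) ∂μ = ∫ x, ‖u x‖ ^ 3 ∂μ :=
    integral_congr_ae (Eventually.of_forall fun x => mul_one _)
  have e2 : ∫ x, (‖u x‖ ^ 3) ^ (10 / 9 : ℝ) ∂μ = ∫ x, ‖u x‖ ^ (10 / 3 : ℝ) ∂μ := by
    refine integral_congr_ae (Eventually.of_forall fun x => ?_)
    show (‖u x‖ ^ 3) ^ (10 / 9 : ℝ) = ‖u x‖ ^ (10 / 3 : ℝ)
    rw [show (‖u x‖ ^ 3 : ℝ) = ‖u x‖ ^ (3 : ℝ) by norm_cast, ← Real.rpow_mul (norm_nonneg _)]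
    norm_num
  have e3 : ∫ x, (1 : ℝ) ^ (10 : ℝ) ∂μ = μ.real univ := by
    simp [integral_const]
  rw [e1, e2, e3] at key
  calc ∫ x, ‖u x‖ ^ 3 ∂μ
      ≤ (∫ x, ‖u x‖ ^ (10 / 3 : ℝ) ∂μ) ^ (1 / (10 / 9) : ℝ) * μ.real univ ^ (1 / 10 : ℝ) := key
    _ = μ.real univ ^ (1 / 10 : ℝ) * (∫ x, ‖u x‖ ^ (10 / 3 : ℝ) ∂μ) ^ (9 / 10 : ℝ) := by
        rw [mul_comm]; norm_num

/-- **Hölder with exponents `3/2`, `3`**: `∫ |q| |u| dμ ≤ (∫ |q|^{3/2} dμ)^{2/3} (∫ |u|³ dμ)^{1/3}`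
for `q ∈ L^{3/2}(μ)` (real valued) and `u ∈ L³(μ)`. [folklore] -/
theorem integral_abs_mul_norm_le_rpow {q : X → ℝ} {u : X → F}
    (hq : MemLp q (ENNReal.ofReal (3 / 2)) μ) (hu : MemLp u (ENNReal.ofReal 3) μ) :
    ∫ x, |q x| * ‖u x‖ ∂μ ≤
      (∫ x, |q x| ^ (3 / 2 : ℝ) ∂μ) ^ (2 / 3 : ℝ) * (∫ x, ‖u x‖ ^ 3 ∂μ) ^ (1 / 3 : ℝ) := by
  have hpq : (3 / 2 : ℝ).HolderConjugate 3 := Real.holderConjugate_iff.2 ⟨by norm_num, by norm_num⟩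
  have hq' : MemLp (fun x => |q x|) (ENNReal.ofReal (3 / 2)) μ := hq.abs
  have hu' : MemLp (fun x => ‖u x‖) (ENNReal.ofReal 3) μ := hu.norm
  have key := integral_mul_le_Lp_mul_Lq_of_nonneg hpq
    (Eventually.of_forall fun x => abs_nonneg _) (Eventually.of_forall fun x => norm_nonneg _)
    hq' hu'
  have e3 : ∫ x, ‖u x‖ ^ (3 : ℝ) ∂μ = ∫ x, ‖u x‖ ^ 3 ∂μ :=
    integral_congr_ae (Eventually.of_forall fun x => by norm_cast)
  rw [e3] at key
  calc ∫ x, |q x| * ‖u x‖ ∂μ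
      ≤ (∫ x, |q x| ^ (3 / 2 : ℝ) ∂μ) ^ (1 / (3 / 2) : ℝ) * (∫ x, ‖u x‖ ^ 3 ∂μ) ^ (1 / 3 : ℝ) := key
    _ = (∫ x, |q x| ^ (3 / 2 : ℝ) ∂μ) ^ (2 / 3 : ℝ) * (∫ x, ‖u x‖ ^ 3 ∂μ) ^ (1 / 3 : ℝ) := by
        norm_num

end SereginSverak2002

end Literature.Analysis.FluidPDE

end
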